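import Mathlib
import HarnessLib
import Literature.MathematicalPhysics.StatisticalMechanics.RenormalisationMap
import Literature.MathematicalPhysics.StatisticalMechanics.GradientFieldNorms

/-!
# The initial polymer activity `K_0(X, φ) = ∏_{x ∈ X} 𝒦(∇φ(x))` of a single-site gradient
# perturbation ([ABKM19] (4.1)–(4.2), (4.6)): the scale-`0` input of the renormalisation group

The renormalisation group of Adams–Buchholz–Kotecký–Müller starts from the polymer expansion of the
perturbed Gaussian integrand: for a single-site perturbation `𝒦 : ℝ^d → 𝕜` of the gradient,
`∏_{x ∈ Λ} (1 + 𝒦(∇φ(x))) = Σ_{X ⊆ Λ} K_0(X, φ)`, `K_0(X, φ) = ∏_{x∈X} 𝒦(∇φ(x))` ((4.1)–(4.2)), i.e.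
`(1^∘ ∘ K_0)(Λ) = (e^{−H_0} ∘_0 K_0)(Λ)` with `H_0 = 0` in the polymer algebra at scale `0`
(block side `s = 1`: blocks are points, every set is a `0`-polymer).  This file records `K_0` and
the structural properties that the renormalisation transformation `T_k` propagates
(`RenormalisationMap`: Lemma 6.4): `K_0(∅) = 1`, factorisation over disjoint (a fortiori strictly
disjoint) sets, translation invariance under all of `ℤ^d`, gauge-locality on `X` itself,
measurability, and — for `𝕜 = ℂ` — `ι`-symmetry `K_0(X, −φ) = conj K_0(X, φ)` when
`𝒦(−z) = conj 𝒦(z)`.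

* scale `0`: `blockOf_one` (`B_x = {x}`), `isPolymer_one`, `blocks_one`, `bprod_one_eq_prod`;
* `initK 𝒦 X φ = ∏_{x∈X} 𝒦(gradAt x φ)`; `initK_empty`, `initK_union`, `factorises_initK`,
  `transInv_initK`, `isGaugeLocal_initK`, `measurable_initK`, `initK_neg_of_conj`;
* **`prod_one_add_eq_pcirc_initK`** — `∏_{x∈Λ} (1 + 𝒦(∇φ(x))) = (K_0 ∘_0 e^{−0})(Λ, φ)
  = Σ_{X} K_0(X, φ)` in the form consumed by `rgStep_identity` (`expNegH 0 = 1`).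

Everything is proved; no named fact.

## References
* S. Adams, S. Buchholz, R. Kotecký, S. Müller, arXiv:1910.13564, Ch. 4.1 (4.1)–(4.2), (4.6),
  Ch. 6.3 (the initial data `H_0 = 0`, `K_0`), Lemma 12.3 [AdamsBuchholzKoteckyMuller2019].
-/

noncomputable section

namespace Literature.MathematicalPhysics.StatisticalMechanics.GradientRG

open scoped BigOperators Classical ComplexConjugate
open Finset MeasureTheory
open Literature.MathematicalPhysics.StatisticalMechanics.TorusPolymer
  hiding translate translate_translate translate_zero translate_empty translate_union translate_sdiff
    translate_inj translate_biUnion translate_subset_translate_iff mem_translate add_mem_translate_iff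
    card_translate
open Literature.MathematicalPhysics.StatisticalMechanics.GradientFRD (fwdDiff iterDiff)

variable {d M : ℕ} [NeZero M]

/-! ## Scale `0`: blocks are points -/

/-- At block side `1` the block of `x` is `{x}`. [cite: AdamsBuchholzKoteckyMuller2019, Ch. 6.2 (𝓑_0 = Λ)] -/
theorem blockOf_one (x : Fin d → ZMod M) : blockOf 1 x = {x} := by
  ext y
  rw [mem_blockOf, mem_singleton]
  constructor
  · intro h
    funext i
    have hi := h i
    rw [cubeIndex_eq_resIndex, cubeIndex_eq_resIndex] at hi
    unfold TorusPolymer.resIndex at hi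
    simp only [Nat.cast_one, sub_self, EuclideanDomain.zero_div, add_zero, Int.ediv_one] at hi
    have := congrArg (fun z : ℤ => (z : ZMod M)) hi
    simpa [ZMod.coe_valMinAbs] using this.symm
  · rintro rfl; exact sameBlock_refl 1 _

/-- At block side `1` every set is a polymer. [cite: AdamsBuchholzKoteckyMuller2019, Ch. 6.2 (𝓟_0)] -/
theorem isPolymer_one (X : Finset (Fin d → ZMod M)) : IsPolymer 1 X := fun x hx => by
  rw [blockOf_one]; exact singleton_subset_iff.2 hx

/-- At block side `1` the blocks of `X` are its singletons. [cite: AdamsBuchholzKoteckyMuller2019, Ch. 6.2] -/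
theorem blocks_one (X : Finset (Fin d → ZMod M)) : blocks 1 X = X.image fun x => ({x} : Finset _) := by
  unfold blocks
  exact image_congr fun x _ => blockOf_one x

/-- At block side `1` block products are products over sites: `F^X = ∏_{x∈X} F({x})`.
[cite: AdamsBuchholzKoteckyMuller2019, Ch. 4.1 (4.6)] -/
theorem bprod_one_eq_prod {R' : Type*} [CommRing R'] (F : Finset (Fin d → ZMod M) → R')
    (X : Finset (Fin d → ZMod M)) : bprod 1 F X = ∏ x ∈ X, F {x} := by
  rw [bprod, blocks_one, prod_image fun x _ y _ h => singleton_injective h]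

/-! ## The initial activity -/

/-- **`K_0(X, φ) = ∏_{x ∈ X} 𝒦(∇φ(x))`** — the polymer activity of a single-site gradient
perturbation `𝒦`. [cite: AdamsBuchholzKoteckyMuller2019, Ch. 4.1 (4.2)] -/
def initK {𝕜 : Type*} [CommRing 𝕜] (𝒦 : (Fin d → ℝ) → 𝕜) (X : Finset (Fin d → ZMod M))
    (φ : (Fin d → ZMod M) → ℝ) : 𝕜 :=
  ∏ x ∈ X, 𝒦 (gradAt x φ)

section Basic

variable {𝕜 : Type*} [CommRing 𝕜] (𝒦 : (Fin d → ℝ) → 𝕜)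

omit [NeZero M] in
/-- `K_0(∅) = 1`. [cite: AdamsBuchholzKoteckyMuller2019, Ch. 4.1 ("F(∅) = G(∅) = 1")] -/
@[simp] theorem initK_empty (φ : (Fin d → ZMod M) → ℝ) : initK 𝒦 ∅ φ = 1 := by simp [initK]

omit [NeZero M] in
/-- **`K_0` factorises over disjoint unions.** [cite: AdamsBuchholzKoteckyMuller2019, Ch. 4.1 ("if F and G factor")] -/
theorem initK_union {X₁ X₂ : Finset (Fin d → ZMod M)} (h : Disjoint X₁ X₂) (φ : (Fin d → ZMod M) → ℝ) :
    initK 𝒦 (X₁ ∪ X₂) φ = initK 𝒦 X₁ φ * initK 𝒦 X₂ φ := by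
  unfold initK; rw [prod_union h]

omit [NeZero M] in
/-- `K_0({x}) = 𝒦(∇φ(x))`. [cite: AdamsBuchholzKoteckyMuller2019, Ch. 4.1 (4.2)] -/
@[simp] theorem initK_singleton (x : Fin d → ZMod M) (φ : (Fin d → ZMod M) → ℝ) :
    initK 𝒦 {x} φ = 𝒦 (gradAt x φ) := by simp [initK]

omit [NeZero M] in
/-- The gradient vector is translation covariant: `∇(τ_a φ)(x + a) = ∇φ(x)`.
[cite: AdamsBuchholzKoteckyMuller2019, Ch. 6.2] -/
theorem gradAt_add_fieldShift (x a : Fin d → ZMod M) (φ : (Fin d → ZMod M) → ℝ) :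
    gradAt (x + a) (fieldShift a φ) = gradAt x φ := by
  funext i
  simp only [gradAt_apply, fwdDiff_fieldShift_add]

omit [NeZero M] in
/-- **`K_0` is translation invariant under all of `ℤ^d`** (hence on every scale).
[cite: AdamsBuchholzKoteckyMuller2019, Ch. 6.2] -/
theorem initK_translate (a : Fin d → ZMod M) (X : Finset (Fin d → ZMod M)) (φ : (Fin d → ZMod M) → ℝ) :
    initK 𝒦 (TorusPolymer.translate a X) (fieldShift a φ) = initK 𝒦 X φ := by
  unfold initK TorusPolymer.translate
  rw [prod_image fun x _ y _ h => add_right_cancel h]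
  exact prod_congr rfl fun x _ => by rw [gradAt_add_fieldShift]

omit [NeZero M] in
/-- The gradient vector is odd in the field. [cite: AdamsBuchholzKoteckyMuller2019, Ch. 6.2] -/
theorem gradAt_neg (x : Fin d → ZMod M) (φ : (Fin d → ZMod M) → ℝ) : gradAt x (-φ) = -gradAt x φ :=
  map_neg (gradAt x) φ

end Basic

section Structure

variable {𝕜 : Type*} [RCLike 𝕜] (𝒦 : (Fin d → ℝ) → 𝕜)

/-- `K_0` factorises on scale `0` in the sense of `RenormalisationMap.Factorises` (`𝕜 = ℂ`).
[cite: AdamsBuchholzKoteckyMuller2019, Lemma 6.4 (5) (6.35) at k = 0] -/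
theorem factorises_initK (𝒦 : (Fin d → ℝ) → ℂ) : Factorises (M := M) 1 (initK 𝒦) :=
  fun X₁ X₂ _ _ hsep φ => initK_union 𝒦 (hsep.disjoint (by norm_num)) φ

omit [NeZero M] in
/-- `K_0` is translation invariant on scale `0` (`TransInv 1`), indeed on every scale.
[cite: AdamsBuchholzKoteckyMuller2019, Lemma 6.4 (1) at k = 0] -/
theorem transInv_initK (s : ℕ) : TransInv s (initK (M := M) 𝒦) :=
  fun a _ X φ => initK_translate 𝒦 a X φ

/-- **`K_0(X, ·)` is gauge-local on every `S ⊇ X`** (`p ≥ 1`): it only sees `∇φ(x)`, `x ∈ X`.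
[cite: AdamsBuchholzKoteckyMuller2019, Lemma 12.3 (I(𝒦) is local)] -/
theorem isGaugeLocal_initK {𝔥 R : ℝ} (h𝔥 : 0 < 𝔥) (hR : 0 < R) {p : ℕ} (hp : 1 ≤ p)
    {S X : Finset (Fin d → ZMod M)} (hXS : X ⊆ S) :
    IsGaugeLocal (fieldGauge 𝔥 R p S) (initK 𝒦 X) := by
  intro φ ψ h
  unfold initK
  exact prod_congr rfl fun x hx => isGaugeLocal_comp_gradAt h𝔥 hR hp (hXS hx) 𝒦 φ ψ h

/-- In particular `K_0(X, ·)` is local on `X + [−r,r]^d` for every `r` (the hypothesis of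
`isGaugeLocal_nextKStep` / `factorises_nextKStep` at `k = 0`). [cite: AdamsBuchholzKoteckyMuller2019, Lemma 12.3] -/
theorem isGaugeLocal_initK_thicken {𝔥 R : ℝ} (h𝔥 : 0 < 𝔥) (hR : 0 < R) {p : ℕ} (hp : 1 ≤ p) (r : ℕ)
    (X : Finset (Fin d → ZMod M)) : IsGaugeLocal (fieldGauge 𝔥 R p (thicken r X)) (initK 𝒦 X) :=
  isGaugeLocal_initK 𝒦 h𝔥 hR hp (subset_thicken r X)

/-- `K_0(X, ·)` is measurable when `𝒦` is. [cite: AdamsBuchholzKoteckyMuller2019, Ch. 4.1 (4.2)] -/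
theorem measurable_initK (h𝒦 : Measurable 𝒦) (X : Finset (Fin d → ZMod M)) : Measurable (initK 𝒦 X) := by
  unfold initK
  refine Finset.measurable_prod _ fun x _ => h𝒦.comp ?_
  exact (gradAt x).toContinuousLinearMap |>.continuous.measurable
    |> fun h => by simpa using (LinearMap.continuous_of_finiteDimensional (gradAt (M := M) x)).measurable

omit [NeZero M] in
/-- **`ι`-symmetry at scale `0`**: if `𝒦(−z) = conj 𝒦(z)` then `K_0(X, −φ) = conj K_0(X, φ)`.
[cite: AdamsBuchholzKoteckyMuller2019, Ch. 4.1 (4.2)] -/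
theorem initK_neg_of_conj (𝒦 : (Fin d → ℝ) → ℂ) (h𝒦 : ∀ z, 𝒦 (-z) = conj (𝒦 z))
    (X : Finset (Fin d → ZMod M)) (φ : (Fin d → ZMod M) → ℝ) :
    initK 𝒦 X (-φ) = conj (initK 𝒦 X φ) := by
  unfold initK
  rw [map_prod]
  exact prod_congr rfl fun x _ => by rw [gradAt_neg, h𝒦]

end Structure

/-! ## The polymer expansion of the perturbed integrand -/

omit [NeZero M] in
/-- The zero Hamiltonian has Boltzmann factor `1`. [cite: AdamsBuchholzKoteckyMuller2019, Ch. 4.1 (H_0 = 0)] -/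
@[simp] theorem expNegH_zero (B : Finset (Fin d → ZMod M)) (φ : (Fin d → ZMod M) → ℝ) :
    expNegH (0 : RelevantHamiltonian ℂ d) B φ = 1 := by
  simp [expNegH]

/-- **`∏_{x ∈ Λ} (1 + 𝒦(∇φ(x))) = (K_0 ∘_0 e^{−0})(Λ, φ) = Σ_X K_0(X, φ)`** — the polymer expansion
of the perturbed integrand ((4.1)–(4.2)) in the form of the left-hand side of `rgStep_identity` at
`k = 0` (block side `1`, `H_0 = 0`). [cite: AdamsBuchholzKoteckyMuller2019, Ch. 4.1 (4.1)–(4.2), (4.6)] -/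
theorem prod_one_add_eq_pcirc_initK (𝒦 : (Fin d → ℝ) → ℂ) (φ : (Fin d → ZMod M) → ℝ) :
    ∏ x : Fin d → ZMod M, (1 + 𝒦 (gradAt x φ)) =
      pcirc 1 (fun Z => expNegH (0 : RelevantHamiltonian ℂ d) Z φ) (fun Y => initK 𝒦 Y φ) univ := by
  have h1 : pcirc 1 (fun Z => expNegH (0 : RelevantHamiltonian ℂ d) Z φ) (fun Y => initK 𝒦 Y φ) univ =
      pcirc 1 (bprod 1 fun _ => (1 : ℂ)) (bprod 1 fun B => initK 𝒦 B φ) univ := by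
    refine (pcirc_congr_left _ fun Z _ _ => by simp).trans (pcirc_congr_right _ (isPolymer_one _) fun Y _ _ => ?_)
    rw [bprod_one_eq_prod]
    unfold initK
    simp
  rw [h1, pcirc_bprod_bprod _ _ (isPolymer_one _), bprod_one_eq_prod]
  simp [initK]

end Literature.MathematicalPhysics.StatisticalMechanics.GradientRG

end
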